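import Literature.Computability.AlgebraicComplexity.BorderRankMatMulThreeKernelBound
import Literature.Computability.AlgebraicComplexity.BorderRankMatMulThreeProfile
import HarnessLib

/-!
# Borel-fixed `(110)`-candidates of `⟨3,3,3⟩`, IX: the model of a profile inside the kernel's span

Topic `Literature/Computability/AlgebraicComplexity`. Link between the block models of
`BorderRankMatMulThreeCover.lean` (`MatMul3.model Rf δf df`, subspaces of `K^{A ⊗ B}`) and the
kernel procedure `BorderRankMatMulThreeKernel.lean` (profiles as lists of codes, model vectors
`Ker.mvecs`, certified bounds `Ker.boundT`, verdict `Ker.verdictH`):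

* `MatMul3.encodeR`, `MatMul3.encodeProf` — the canonical code of a profile;
* `MatMul3.varOf d`, `MatMul3.αOf`, `MatMul3.βOf` — the variant of a free diagonal `d`
  (`⟨1, d⟩ = ⟨1, (0, d₁-d₀, d₂-d₀)⟩`; generic, or `⟨1,e₀⟩`, `⟨1,e₁⟩`, `⟨1,e₂⟩` when two entries agree);
* `MatMul3.model_le_kspan` — **the model lies in the span of the kernel's model vectors** of the
  encoded profile under the variant of its free block (used with the covering theorem and the
  soundness of `Ker.boundT` in `BorderRankMatMulThreeVerdict.lean`).

## References

* A. Conner, A. Harper, J. M. Landsberg, *New lower bounds for matrix multiplication and `det₃`*,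
  Forum Math. Pi 11 (2023) e17, arXiv:1911.07981 — §6. [ConnerHarperLandsberg2023]
-/

noncomputable section

open scoped BigOperators

namespace Literature.Computability.AlgebraicComplexity

namespace BorderApolarity

namespace MatMul3

universe u

variable {K : Type u} [Field K]

/-! ## Encoding profiles -/

/-- The nine matrix positions in lexicographic order. [folklore] -/
def allPairs : List (Fin 3 × Fin 3) :=
  [(0,0),(0,1),(0,2),(1,0),(1,1),(1,2),(2,0),(2,1),(2,2)]

/-- Every position occurs in `allPairs`. [folklore] -/
theorem mem_allPairs (p : Fin 3 × Fin 3) : p ∈ allPairs := by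
  revert p; decide

/-- `allPairs` has no duplicates. [folklore] -/
theorem nodup_allPairs : allPairs.Nodup := by decide

/-- The canonical code of a set of root positions. [folklore] -/
def encodeR (R : Finset (Fin 3 × Fin 3)) : List (ℕ × ℕ) :=
  (allPairs.filter fun p => p ∈ R).map fun p => ((p.1 : ℕ), (p.2 : ℕ))

/-- Membership in the code. [folklore] -/
theorem mem_encodeR {R : Finset (Fin 3 × Fin 3)} {i i' : Fin 3} :
    ((i : ℕ), (i' : ℕ)) ∈ encodeR R ↔ (i, i') ∈ R := by
  simp only [encodeR, List.mem_map, List.mem_filter, decide_eq_true_eq]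
  constructor
  · rintro ⟨⟨j, j'⟩, ⟨-, hmem⟩, h⟩
    simp only [Prod.mk.injEq] at h
    have h1 : j = i := Fin.ext h.1
    have h2 : j' = i' := Fin.ext h.2
    subst h1; subst h2; exact hmem
  · intro h; exact ⟨(i, i'), ⟨mem_allPairs _, h⟩, rfl⟩

/-- `List.contains` on the code is membership. [folklore] -/
theorem contains_encodeR (R : Finset (Fin 3 × Fin 3)) (i i' : Fin 3) :
    (encodeR R).contains ((i : ℕ), (i' : ℕ)) = decide ((i, i') ∈ R) := by
  rw [Bool.eq_iff_iff, List.contains_iff_mem, mem_encodeR, decide_eq_true_iff]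

/-- The length of the code is the cardinality. [folklore] -/
theorem length_encodeR (R : Finset (Fin 3 × Fin 3)) : (encodeR R).length = R.card := by
  rw [encodeR, List.length_map, ← List.toFinset_card_of_nodup (nodup_allPairs.filter _)]
  congr 1
  ext p
  simp [mem_allPairs]

/-- Block code `3j + k` of block `(j, k)`. [folklore] -/
def jkCode (jk : Fin 3 × Fin 3) : ℕ := 3 * (jk.1 : ℕ) + (jk.2 : ℕ)

/-- Decoding a block code. [folklore] -/
def jkDecode (n : ℕ) : Fin 3 × Fin 3 := (⟨n / 3 % 3, Nat.mod_lt _ (by decide)⟩, ⟨n % 3, Nat.mod_lt _ (by decide)⟩)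

/-- `jkDecode (jkCode jk) = jk`. [folklore] -/
theorem jkDecode_jkCode (jk : Fin 3 × Fin 3) : jkDecode (jkCode jk) = jk := by
  obtain ⟨j, k⟩ := jk
  have hj := j.isLt; have hk := k.isLt
  simp only [jkDecode, jkCode]
  refine Prod.ext (Fin.ext ?_) (Fin.ext ?_) <;> (simp; try omega)

/-- `jkCode jk < 9`, `jkCode jk % 3 = k`, `jkCode jk / 3 = j`. [folklore] -/
theorem jkCode_spec (jk : Fin 3 × Fin 3) : jkCode jk < 9 ∧ jkCode jk % 3 = jk.2 ∧ jkCode jk / 3 = jk.1 := by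
  have := jk.1.isLt; have := jk.2.isLt; simp only [jkCode]; omega

/-- **The code of a profile** `(Rf, δf)`: nine block codes in the order `3j + k`. [folklore] -/
def encodeProf (Rf : Fin 3 × Fin 3 → Finset (Fin 3 × Fin 3)) (δf : Fin 3 × Fin 3 → ℕ) :
    List (List (ℕ × ℕ) × ℕ) :=
  (List.range 9).map fun n => (encodeR (Rf (jkDecode n)), δf (jkDecode n))

/-- The block of the code at `jkCode jk`. [folklore] -/
theorem encodeProf_getD (Rf : Fin 3 × Fin 3 → Finset (Fin 3 × Fin 3)) (δf : Fin 3 × Fin 3 → ℕ)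
    (jk : Fin 3 × Fin 3) : (encodeProf Rf δf).getD (jkCode jk) ([], 0) = (encodeR (Rf jk), δf jk) := by
  rw [encodeProf, List.getD_eq_getElem?_getD, List.getElem?_map, List.getElem?_range (jkCode_spec jk).1]
  simp [jkDecode_jkCode]

/-- **The kernel's diagonal type code agrees with `dtypeOf`.** [folklore] -/
theorem dcode_encodeR (R : Finset (Fin 3 × Fin 3)) (δ : ℕ) :
    Ker.dcode (encodeR R) δ = (match dtypeOf R δ with
      | .id => 0 | .e0 => 1 | .e2 => 2 | .c01 => 3 | .c12 => 4 | .free => 5 | .all => 6) := by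
  simp only [Ker.dcode, dtypeOf,
    show ((1 : ℕ), (0 : ℕ)) = (((1 : Fin 3) : ℕ), ((0 : Fin 3) : ℕ)) from rfl,
    show ((2 : ℕ), (1 : ℕ)) = (((2 : Fin 3) : ℕ), ((1 : Fin 3) : ℕ)) from rfl,
    show ((1 : ℕ), (2 : ℕ)) = (((1 : Fin 3) : ℕ), ((2 : Fin 3) : ℕ)) from rfl,
    show ((0 : ℕ), (1 : ℕ)) = (((0 : Fin 3) : ℕ), ((1 : Fin 3) : ℕ)) from rfl, contains_encodeR]
  split_ifs <;> simp_all

/-! ## The variant of a free diagonal -/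

/-- `α = d₁ - d₀`. [folklore] -/
def αOf (d : Fin 3 → K) : K := d 1 - d 0

/-- `β = d₂ - d₀`. [folklore] -/
def βOf (d : Fin 3 → K) : K := d 2 - d 0

open Classical in
/-- The variant of a free diagonal: `0` generic (`α, β, α-β ≠ 0`), `1` (`⟨1,e₀⟩`, `α = β`),
`3` (`⟨1,e₂⟩`, `α = 0`), `2` (`⟨1,e₁⟩`, `β = 0`). [folklore] -/
def varOf (d : Fin 3 → K) : ℕ :=
  if αOf d ≠ 0 ∧ βOf d ≠ 0 ∧ αOf d ≠ βOf d then 0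
  else if αOf d = βOf d then 1 else if αOf d = 0 then 3 else 2

/-- The kernel's second diagonal generator of the free type under a variant, over `K`. [folklore] -/
def dvar (var : ℕ) (α β : K) : Fin 3 → K :=
  if var = 0 then ![0, α, β] else if var = 1 then Pi.single 0 1
  else if var = 2 then Pi.single 1 1 else Pi.single 2 1

/-- The generic variant has `α, β, α - β ≠ 0`. [folklore] -/
theorem varOf_zero {d : Fin 3 → K} (h : varOf d = 0) : αOf d ≠ 0 ∧ βOf d ≠ 0 ∧ αOf d ≠ βOf d := by
  unfold varOf at h
  split_ifs at h with h1
  exact h1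

/-- `varOf d ≤ 3`. [folklore] -/
theorem varOf_le (d : Fin 3 → K) : varOf d ≤ 3 := by
  unfold varOf; split_ifs <;> omega

/-- **A free diagonal lies in the plane of its variant**: `d ∈ ⟨1, dvar (varOf d) α β⟩`. [folklore] -/
theorem mem_span_dvar (d : Fin 3 → K) :
    d ∈ Submodule.span K ({(fun _ => (1 : K)), dvar (varOf d) (αOf d) (βOf d)} : Set (Fin 3 → K)) := by
  have mem2 : ∀ (a b : K) (v : Fin 3 → K), d = a • (fun _ => (1 : K)) + b • v →
      d ∈ Submodule.span K ({(fun _ => (1 : K)), v} : Set (Fin 3 → K)) := by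
    intro a b v h
    rw [h]
    exact Submodule.add_mem _ (Submodule.smul_mem _ _ (Submodule.subset_span (by simp)))
      (Submodule.smul_mem _ _ (Submodule.subset_span (by simp)))
  unfold varOf
  by_cases h0 : αOf d ≠ 0 ∧ βOf d ≠ 0 ∧ αOf d ≠ βOf d
  · rw [if_pos h0]
    refine mem2 (d 0) 1 _ ?_
    funext i; simp only [dvar, if_true, Pi.add_apply, Pi.smul_apply, smul_eq_mul, one_mul]
    fin_cases i <;> simp [αOf, βOf]
  rw [if_neg h0]
  by_cases h1 : αOf d = βOf d
  · rw [if_pos h1]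
    -- `d = (d₀ + α) · 1 - α e₀`
    refine mem2 (d 0 + αOf d) (-αOf d) _ ?_
    have h1' : d 2 = d 1 := by simp only [αOf, βOf] at h1; linear_combination -h1
    funext i
    simp only [dvar, show (1 : ℕ) ≠ 0 from one_ne_zero, if_false, if_true, Pi.add_apply, Pi.smul_apply,
      smul_eq_mul, mul_one]
    fin_cases i <;> simp [αOf, h1']
  rw [if_neg h1]
  by_cases h2 : αOf d = 0
  · rw [if_pos h2]
    -- `α = 0`: `d = d₀ · 1 + β e₂`
    refine mem2 (d 0) (βOf d) _ ?_
    have h2' : d 1 = d 0 := by simp only [αOf] at h2; linear_combination h2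
    funext i
    simp only [dvar, show (3 : ℕ) ≠ 0 from by decide, show (3 : ℕ) ≠ 1 from by decide,
      show (3 : ℕ) ≠ 2 from by decide, if_false, Pi.add_apply, Pi.smul_apply, smul_eq_mul, mul_one]
    fin_cases i <;> simp [βOf, h2']
  · rw [if_neg h2]
    -- `β = 0`: `d = d₀ · 1 + α e₁`
    have hβ : βOf d = 0 := by
      push Not at h0
      by_contra hβ
      exact h1 (h0 h2 hβ)
    refine mem2 (d 0) (αOf d) _ ?_
    have h3' : d 2 = d 0 := by simp only [βOf] at hβ; linear_combination hβ
    funext i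
    simp only [dvar, show (2 : ℕ) ≠ 0 from two_ne_zero, show (2 : ℕ) ≠ 1 from by decide, if_false, if_true,
      Pi.add_apply, Pi.smul_apply, smul_eq_mul, mul_one]
    fin_cases i <;> simp [αOf, h3']

/-! ## Model vectors of the kernel as the model's generators -/

/-- The kernel's span: the model vectors of a profile under a variant, over `K`. [folklore] -/
def kspan (prof : List (List (ℕ × ℕ) × ℕ)) (var : ℕ) (α β : K) : Submodule K (I9' × I9' → K) :=
  Submodule.span K (Set.range fun i : Fin (Ker.mvecs prof var).length =>
    Ker.MVec.toFun α β ((Ker.mvecs prof var).get i))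

/-- `dim kspan ≤` the number of model vectors. [folklore] -/
theorem finrank_kspan_le (prof : List (List (ℕ × ℕ) × ℕ)) (var : ℕ) (α β : K) :
    Module.finrank K (kspan prof var α β) ≤ (Ker.mvecs prof var).length := by
  rw [kspan]
  exact (finrank_range_le_card _).trans (by simp)

/-- Members of the vector list lie in the kernel's span. [folklore] -/
theorem toFun_mem_kspan {prof : List (List (ℕ × ℕ) × ℕ)} {var : ℕ} (α β : K) {v : Ker.MVec}
    (hv : v ∈ Ker.mvecs prof var) : v.toFun α β ∈ kspan prof var α β := by
  obtain ⟨i, rfl⟩ := List.mem_iff_get.1 hv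
  exact Submodule.subset_span ⟨i, rfl⟩

/-- The unit vector of a block is the kernel's unit. [folklore] -/
theorem unitVec_eq_toFun (α β : K) (jk : Fin 3 × Fin 3) (i i' : Fin 3) :
    unitVec (K := K) jk.1 jk.2 i i' = Ker.MVec.toFun α β (.unit (jkCode jk) i i') := by
  obtain ⟨-, hmod, hdiv⟩ := jkCode_spec jk
  funext c
  rw [← blk_eta c, unitVec_blk]
  simp only [Ker.MVec.toFun, Ker.MVec.val, blk, codeA_mod, codeA_div, hmod, hdiv, Fin.val_inj]
  split_ifs with h1 h2 h2
  · simp [Ker.LF.eval]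
  · exact absurd ⟨h1.2.1, h1.1, h1.2.2.1, h1.2.2.2⟩ h2
  · exact absurd ⟨h2.2.1, h2.1, h2.2.2.1, h2.2.2.2⟩ h1
  · simp [Ker.LF.eval]

/-- An integer diagonal vector of a block is the kernel's diagonal vector of its code. [folklore] -/
theorem diagVec_eq_toFun (α β : K) (jk : Fin 3 × Fin 3) (c : Fin 3 → ℤ) (gc : List Ker.LF)
    (hgc : ∀ i : Fin 3, gc.getD i (0, 0, 0) = ((c i), 0, 0)) :
    diagVec jk.1 jk.2 (fun i => (c i : K)) = Ker.MVec.toFun α β (.diag (jkCode jk) gc) := by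
  obtain ⟨-, hmod, hdiv⟩ := jkCode_spec jk
  funext x
  obtain ⟨⟨i, k'⟩, ⟨i', j'⟩⟩ := x
  rw [show (((i, k'), (i', j')) : I9' × I9') = blk j' k' i i' from rfl, diagVec_blk]
  simp only [Ker.MVec.toFun, Ker.MVec.val, blk, codeA_mod, codeA_div, hmod, hdiv, Fin.val_inj]
  by_cases hc : k' = jk.2 ∧ j' = jk.1 ∧ i = i'
  · rw [if_pos hc, if_pos hc, hgc]; simp [Ker.LF.eval]
  · rw [if_neg hc, if_neg hc]; simp [Ker.LF.eval]

/-- The kernel's second free generator under a variant is `dvar`. [folklore] -/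
theorem dvar_eq_toFun (α β : K) (jk : Fin 3 × Fin 3) {var : ℕ} (hvar : var ≤ 3) :
    diagVec jk.1 jk.2 (dvar var α β) =
      Ker.MVec.toFun α β (.diag (jkCode jk) (((Ker.dgensN 5 var).getD 1 []))) := by
  obtain ⟨-, hmod, hdiv⟩ := jkCode_spec jk
  funext x
  obtain ⟨⟨i, k'⟩, ⟨i', j'⟩⟩ := x
  rw [show (((i, k'), (i', j')) : I9' × I9') = blk j' k' i i' from rfl, diagVec_blk]
  simp only [Ker.MVec.toFun, Ker.MVec.val, blk, codeA_mod, codeA_div, hmod, hdiv, Fin.val_inj]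
  by_cases hc : k' = jk.2 ∧ j' = jk.1 ∧ i = i'
  · rw [if_pos hc, if_pos hc]
    interval_cases var <;> fin_cases i <;> simp [dvar, Ker.dgensN, Ker.LF.eval]
  · rw [if_neg hc, if_neg hc]; simp [Ker.LF.eval]

/-! ## The model inside the kernel's span -/

section Model

variable (Rf : Fin 3 × Fin 3 → Finset (Fin 3 × Fin 3)) (δf : Fin 3 × Fin 3 → ℕ)

/-- Root units of the profile are model vectors of its code. [folklore] -/
theorem unit_mem_mvecs (var : ℕ) (jk : Fin 3 × Fin 3) {i i' : Fin 3} (h : (i, i') ∈ Rf jk) :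
    Ker.MVec.unit (jkCode jk) i i' ∈ Ker.mvecs (encodeProf Rf δf) var := by
  simp only [Ker.mvecs, List.mem_flatMap, List.mem_range, List.mem_append, List.mem_map]
  refine ⟨jkCode jk, (jkCode_spec jk).1, Or.inr ⟨((i : ℕ), (i' : ℕ)), ?_, rfl⟩⟩
  rw [encodeProf_getD]
  exact mem_encodeR.2 h

/-- Diagonal generators of the profile's blocks are model vectors of its code. [folklore] -/
theorem diag_mem_mvecs (var : ℕ) (jk : Fin 3 × Fin 3) {gc : List Ker.LF}
    (h : gc ∈ Ker.dgensN (Ker.dcode (encodeR (Rf jk)) (δf jk)) var) :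
    Ker.MVec.diag (jkCode jk) gc ∈ Ker.mvecs (encodeProf Rf δf) var := by
  simp only [Ker.mvecs, List.mem_flatMap, List.mem_range, List.mem_append, List.mem_map]
  refine ⟨jkCode jk, (jkCode_spec jk).1, Or.inl ⟨gc, ?_, rfl⟩⟩
  rw [encodeProf_getD]
  exact h

variable {Rf δf}

/-- An integer diagonal whose code is a generator lies in the kernel's span. [folklore] -/
theorem diagVec_int_mem_kspan {var : ℕ} (α β : K) (jk : Fin 3 × Fin 3) (c : Fin 3 → ℤ)
    (h : [((c 0 : ℤ), (0 : ℤ), (0 : ℤ)), ((c 1 : ℤ), 0, 0), ((c 2 : ℤ), 0, 0)] ∈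
      Ker.dgensN (Ker.dcode (encodeR (Rf jk)) (δf jk)) var) :
    diagVec jk.1 jk.2 (fun i => (c i : K)) ∈ kspan (encodeProf Rf δf) var α β := by
  rw [diagVec_eq_toFun α β jk c [((c 0 : ℤ), (0 : ℤ), (0 : ℤ)), ((c 1 : ℤ), 0, 0), ((c 2 : ℤ), 0, 0)]
    (fun i => by fin_cases i <;> rfl)]
  exact toFun_mem_kspan α β (diag_mem_mvecs Rf δf var jk h)

/-- **A model block lies in the kernel's span** (the free block under the hypothesis that its
diagonal lies in the plane of the variant). [cite: ConnerHarperLandsberg2023, §6] -/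
theorem blockModel_le_kspan (jk : Fin 3 × Fin 3) (d : Fin 3 → K) {var : ℕ} (hvar : var ≤ 3) (α β : K)
    (hfree : dtypeOf (Rf jk) (δf jk) = .free →
      d ∈ Submodule.span K ({(fun _ => (1 : K)), dvar var α β} : Set (Fin 3 → K))) :
    blockModel jk.1 jk.2 (Rf jk) (δf jk) d ≤ kspan (encodeProf Rf δf) var α β := by
  have hcode := dcode_encodeR (Rf jk) (δf jk)
  -- the constants diagonal is always a generator
  have hone : dtypeOf (Rf jk) (δf jk) ≠ .all →
      diagVec jk.1 jk.2 (fun _ => (1 : K)) ∈ kspan (encodeProf Rf δf) var α β := by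
    intro hne
    have h := diagVec_int_mem_kspan (Rf := Rf) (δf := δf) (var := var) α β jk (fun _ => 1) (by
      rw [hcode]
      revert hne
      cases dtypeOf (Rf jk) (δf jk) <;> intro hne <;> simp [Ker.dgensN] at hne ⊢
      interval_cases var <;> simp)
    simpa using h
  have hsingle : ∀ i₀ : Fin 3, (Pi.single i₀ (1 : K) : Fin 3 → K) = fun i => ((Pi.single i₀ (1 : ℤ) : Fin 3 → ℤ) i : K) := by
    intro i₀; funext i; fin_cases i₀ <;> fin_cases i <;> simp
  refine sup_le (Submodule.span_le.2 ?_) ?_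
  · rintro _ ⟨⟨i, i'⟩, hmem, rfl⟩
    show unitVec (K := K) jk.1 jk.2 i i' ∈ _
    rw [unitVec_eq_toFun α β]
    exact toFun_mem_kspan α β (unit_mem_mvecs Rf δf var jk hmem)
  · rw [Submodule.map_le_iff_le_comap, dmodel, Submodule.span_le]
    intro g hg
    rw [SetLike.mem_coe, Submodule.mem_comap]
    show diagVec jk.1 jk.2 g ∈ kspan (encodeProf Rf δf) var α β
    revert hg
    cases ht : dtypeOf (Rf jk) (δf jk) with
    | id => intro hg; simp only [dgens, Set.mem_singleton_iff] at hg; rw [hg]; exact hone (by rw [ht]; decide)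
    | e0 =>
      intro hg; simp only [dgens, Set.mem_insert_iff, Set.mem_singleton_iff] at hg
      rcases hg with rfl | rfl
      · exact hone (by rw [ht]; decide)
      · rw [hsingle]
        exact diagVec_int_mem_kspan α β jk _ (by rw [hcode, ht]; simp [Ker.dgensN])
    | e2 =>
      intro hg; simp only [dgens, Set.mem_insert_iff, Set.mem_singleton_iff] at hg
      rcases hg with rfl | rfl
      · exact hone (by rw [ht]; decide)
      · rw [hsingle]
        exact diagVec_int_mem_kspan α β jk _ (by rw [hcode, ht]; simp [Ker.dgensN])
    | c01 =>
      intro hg; simp only [dgens, Set.mem_insert_iff, Set.mem_singleton_iff] at hg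
      rcases hg with rfl | rfl
      · exact hone (by rw [ht]; decide)
      · have : (Pi.single 0 (1 : K) - Pi.single 1 1 : Fin 3 → K) =
            fun i => ((Pi.single 0 (1 : ℤ) - Pi.single 1 1 : Fin 3 → ℤ) i : K) := by
          funext i; fin_cases i <;> simp
        rw [this]
        exact diagVec_int_mem_kspan α β jk _ (by rw [hcode, ht]; simp [Ker.dgensN])
    | c12 =>
      intro hg; simp only [dgens, Set.mem_insert_iff, Set.mem_singleton_iff] at hg
      rcases hg with rfl | rfl
      · exact hone (by rw [ht]; decide)
      · have : (Pi.single 1 (1 : K) - Pi.single 2 1 : Fin 3 → K) =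
            fun i => ((Pi.single 1 (1 : ℤ) - Pi.single 2 1 : Fin 3 → ℤ) i : K) := by
          funext i; fin_cases i <;> simp
        rw [this]
        exact diagVec_int_mem_kspan α β jk _ (by rw [hcode, ht]; simp [Ker.dgensN])
    | all =>
      intro _
      -- every diagonal is a combination of `e₀, e₁, e₂`, all generators
      have hg : g = ∑ i₀ : Fin 3, g i₀ • (Pi.single i₀ (1 : K) : Fin 3 → K) := by
        funext i; fin_cases i <;> simp [Fin.sum_univ_three]
      rw [hg, show diagVec jk.1 jk.2 (∑ i₀ : Fin 3, g i₀ • (Pi.single i₀ (1 : K) : Fin 3 → K)) =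
        ∑ i₀ : Fin 3, g i₀ • diagVec jk.1 jk.2 (Pi.single i₀ (1 : K)) from by
          simp only [Fin.sum_univ_three, diagVec_add, diagVec_smul]]
      refine Submodule.sum_mem _ fun i₀ _ => Submodule.smul_mem _ _ ?_
      rw [hsingle]
      refine diagVec_int_mem_kspan α β jk _ (by rw [hcode, ht]; fin_cases i₀ <;> simp [Ker.dgensN])
    | free =>
      intro hg; simp only [dgens, Set.mem_insert_iff, Set.mem_singleton_iff] at hg
      rcases hg with rfl | rfl
      · exact hone (by rw [ht]; decide)
      · -- `d ∈ ⟨1, dvar⟩` and both generators lie in the span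
        have hd := hfree ht
        have hdv : diagVec jk.1 jk.2 (dvar var α β) ∈ kspan (encodeProf Rf δf) var α β := by
          rw [dvar_eq_toFun α β jk hvar]
          refine toFun_mem_kspan α β (diag_mem_mvecs Rf δf var jk ?_)
          rw [hcode, ht]
          interval_cases var <;> simp [Ker.dgensN]
        have hle : Submodule.span K ({(fun _ => (1 : K)), dvar var α β} : Set (Fin 3 → K)) ≤
            (kspan (encodeProf Rf δf) var α β).comap (diagVecLin jk.1 jk.2) :=
          Submodule.span_le.2 (by
            rintro w (rfl | rfl)
            · exact hone (by rw [ht]; decide)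
            · exact hdv)
        exact hle hd

/-- **The model of a profile lies in the kernel's span** of its code under the variant of its free
block `jk₀` (at most one free block). [cite: ConnerHarperLandsberg2023, §6] -/
theorem model_le_kspan (df : Fin 3 × Fin 3 → Fin 3 → K) (jk₀ : Fin 3 × Fin 3)
    (hfree : ∀ jk, dtypeOf (Rf jk) (δf jk) = .free → jk = jk₀) :
    model Rf δf df ≤ kspan (encodeProf Rf δf) (varOf (df jk₀)) (αOf (df jk₀)) (βOf (df jk₀)) := by
  refine iSup_le fun jk => blockModel_le_kspan jk (df jk) (varOf_le _) _ _ fun ht => ?_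
  rw [hfree jk ht]
  exact mem_span_dvar (df jk₀)

end Model

end MatMul3

end BorderApolarity

end Literature.Computability.AlgebraicComplexity

end
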